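import Literature.NumberTheory.LFunctions.WeilCombNodeWeightsMidpoint
import Mathlib.Analysis.SpecialFunctions.ImproperIntegrals
import Mathlib.MeasureTheory.Measure.Haar.NormedSpace
import Mathlib.Analysis.SpecificLimits.Basic
import HarnessLib

/-!
# Node weights of `ζ`-mollified combs, sharp evaluation I: the periodization of the bump autocorrelation

Topic `Literature/NumberTheory/LFunctions`.  The SHARP evaluation of the node weights of a
`ζ`-mollified resonator comb (companion of
`Literature/NumberTheory/LFunctions/WeilCombNodeWeightsNode.lean`, which evaluates them up to a
per-node error `O(1/n)`) organises the double tooth sum at a node by the lattice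
`{(j, k') : ℓ ∣ nℓ'k' + j}`; after the sum over `k'` along each family `j = const` the bump
autocorrelation `B` (even, `C²`, supported in `[-2, 2]`) enters only through its PERIODIZATION
`A(v) = ∑_{m ∈ ℤ} B(m/v)` (`v > 0`), written here without a new definition as `∑' m : ℤ, B (m / v)`,
and through `H(v) = (A(v) - v ∫B)/v`.  This file proves the elementary facts about them:

* `periodization_eq_sum` — `A(v)` is the finite sum over `|m| ≤ N` once `2v < N + 1`;
  `periodization_eq_of_lt_half` — `A(v) = B(0)` for `0 < v < 1/2`;
* `abs_periodization_sub_le` — the midpoint rule: `|A(v) - v ∫B| ≤ 5N₂/(2v)` for `v ≥ 1/2`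
  (`|B''| ≤ N₂`), via `abs_sum_sub_integral_le`;
* `continuousOn_periodization` — `A` is continuous on `(0, ∞)`;
* `integrableOn_periodizationH`, `abs_integral_periodizationH_Ioi_le`,
  `integral_periodizationH_Ioi_eq_add` — `H` is integrable on `(a, ∞)` (`a ≥ 1/2`), its tails are
  `≤ 5N₂/(2X)`, and `∫_{1/2}^∞ H = ∫_{1/2}^X H + ∫_X^∞ H`.

Everything is proved; no named facts (folklore real analysis).
-/

noncomputable section

open MeasureTheory Set intervalIntegral Filter
open scoped Topology

namespace Literature.NumberTheory.LFunctions

section Periodization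

variable {B : ℝ → ℝ}

/-- A continuous function vanishing for `|x| > 2` vanishes for `|x| ≥ 2`. [folklore] -/
theorem eq_zero_of_two_le_abs (hBc : Continuous B) (hBs : ∀ x, 2 < |x| → B x = 0) {x : ℝ}
    (hx : 2 ≤ |x|) : B x = 0 := by
  rcases hx.lt_or_eq with h | h
  · exact hBs x h
  · have key : ∀ n : ℕ, B (x * (1 + 1 / ((n : ℝ) + 1))) = 0 := fun n ↦ hBs _ (by
      have hn : (0 : ℝ) < 1 / ((n : ℝ) + 1) := by positivity
      rw [abs_mul, ← h, abs_of_pos (by positivity)]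
      nlinarith)
    have ht : Tendsto (fun n : ℕ ↦ x * (1 + 1 / ((n : ℝ) + 1))) atTop (𝓝 (x * (1 + 0))) :=
      tendsto_const_nhds.mul (tendsto_const_nhds.add tendsto_one_div_add_atTop_nhds_zero_nat)
    rw [add_zero, mul_one] at ht
    have h1 : Tendsto (fun n : ℕ ↦ B (x * (1 + 1 / ((n : ℝ) + 1)))) atTop (𝓝 (B x)) :=
      (hBc.tendsto x).comp ht
    have h0 : Tendsto (fun n : ℕ ↦ B (x * (1 + 1 / ((n : ℝ) + 1)))) atTop (𝓝 0) :=
      tendsto_const_nhds.congr fun n ↦ (key n).symm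
    exact tendsto_nhds_unique h1 h0

/-- **The periodization is a finite sum**: for `v > 0` and `2v < N + 1`,
`∑_{m ∈ ℤ} B(m/v) = ∑_{|m| ≤ N} B(m/v)` (`B(x) = 0` for `|x| > 2`). [folklore] -/
theorem periodization_eq_sum (hBs : ∀ x, 2 < |x| → B x = 0) {v : ℝ} (hv : 0 < v) {N : ℕ}
    (hN : 2 * v < N + 1) :
    ∑' m : ℤ, B (m / v) = ∑ m ∈ Finset.Icc (-(N : ℤ)) N, B (m / v) := by
  refine tsum_eq_sum fun m hm ↦ hBs _ ?_
  simp only [Finset.mem_Icc, not_and_or, not_le] at hm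
  have habs : (N : ℝ) + 1 ≤ |(m : ℝ)| := by
    rcases hm with h | h
    · have h' : (m : ℝ) ≤ -(N : ℝ) - 1 := by exact_mod_cast (by omega : m ≤ -(N : ℤ) - 1)
      have hN0 : (0 : ℝ) ≤ N := Nat.cast_nonneg N
      rw [abs_of_neg (by linarith)]
      linarith
    · have h' : (N : ℝ) + 1 ≤ m := by exact_mod_cast (by omega : (N : ℤ) + 1 ≤ m)
      have hN0 : (0 : ℝ) ≤ N := Nat.cast_nonneg N
      rw [abs_of_pos (by linarith)]
      linarith
  rw [abs_div, abs_of_pos hv, lt_div_iff₀ hv]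
  linarith

/-- For `0 < v < 1/2` only `m = 0` survives: `∑_{m ∈ ℤ} B(m/v) = B(0)`. [folklore] -/
theorem periodization_eq_of_lt_half (hBs : ∀ x, 2 < |x| → B x = 0) {v : ℝ} (hv : 0 < v)
    (hv2 : v < 1 / 2) : ∑' m : ℤ, B (m / v) = B 0 := by
  rw [periodization_eq_sum hBs hv (N := 0) (by push_cast; linarith)]
  simp

/-- Reindexing `-N ≤ m ≤ N` by `j = m + N < 2N + 1`. [folklore] -/
theorem sum_Icc_neg_eq_sum_range (F : ℝ → ℝ) (N : ℕ) :
    ∑ m ∈ Finset.Icc (-(N : ℤ)) N, F m = ∑ j ∈ Finset.range (2 * N + 1), F (-(N : ℝ) + j) := by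
  refine Finset.sum_nbij' (fun m : ℤ ↦ (m + N).toNat) (fun j : ℕ ↦ (j : ℤ) - N) ?_ ?_ ?_ ?_ ?_
  · intro m hm
    simp only [Finset.mem_Icc] at hm
    simp only [Finset.mem_range]
    omega
  · intro j hj
    simp only [Finset.mem_range] at hj
    simp only [Finset.mem_Icc]
    omega
  · intro m hm
    simp only [Finset.mem_Icc] at hm
    omega
  · intro j _
    simp
  · intro m hm
    simp only [Finset.mem_Icc] at hm
    have h0 : 0 ≤ m + N := by omega
    have hcast : (((m + N).toNat : ℕ) : ℝ) = (m : ℝ) + N := by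
      have h1 : (((m + N).toNat : ℕ) : ℤ) = m + N := Int.toNat_of_nonneg h0
      exact_mod_cast h1
    rw [hcast]
    congr 1
    ring

/-- **The midpoint rule for the periodization.** For `C²` `B` with `|B''| ≤ N₂` vanishing for
`|x| > 2` and `v ≥ 1/2`: `|∑_{m ∈ ℤ} B(m/v) - v ∫ B| ≤ 5N₂/(2v)` (the sum is a midpoint Riemann
sum of `x ↦ B(x/v)` over `≤ 4v + 3` unit cells with `|f''| ≤ N₂/v²`). [folklore] -/
theorem abs_periodization_sub_le {B B' B'' : ℝ → ℝ} {N₂ : ℝ}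
    (hB : ∀ x, HasDerivAt B (B' x) x) (hB' : ∀ x, HasDerivAt B' (B'' x) x)
    (h2 : ∀ x, |B'' x| ≤ N₂) (hBs : ∀ x, 2 < |x| → B x = 0) {v : ℝ} (hv : 1 / 2 ≤ v) :
    |∑' m : ℤ, B (m / v) - v * ∫ x, B x| ≤ 5 * N₂ / (2 * v) := by
  have hv0 : 0 < v := by linarith
  have hN₂ : 0 ≤ N₂ := (abs_nonneg _).trans (h2 0)
  set N : ℕ := ⌈2 * v⌉₊ with hN
  have hN1 : 2 * v ≤ N := Nat.le_ceil _
  have hN2 : (N : ℝ) < 2 * v + 1 := Nat.ceil_lt_add_one (by linarith)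
  rw [periodization_eq_sum hBs hv0 (N := N) (by linarith)]
  set f : ℝ → ℝ := fun x ↦ B (x / v) with hf
  rw [show (∑ m ∈ Finset.Icc (-(N : ℤ)) N, B (m / v)) = ∑ m ∈ Finset.Icc (-(N : ℤ)) N, f m from rfl,
    sum_Icc_neg_eq_sum_range f N]
  -- derivatives of `f`
  set f' : ℝ → ℝ := fun x ↦ B' (x / v) * (1 / v) with hf'
  set f'' : ℝ → ℝ := fun x ↦ B'' (x / v) * (1 / v) * (1 / v) with hf''
  have hfd : ∀ x, HasDerivAt f (f' x) x := fun x ↦ (hB _).comp x ((hasDerivAt_id x).div_const v)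
  have hfd' : ∀ x, HasDerivAt f' (f'' x) x := fun x ↦
    ((hB' _).comp x ((hasDerivAt_id x).div_const v)).mul_const _
  have hD : ∀ x, |f'' x| ≤ N₂ / v ^ 2 := fun x ↦ by
    simp only [hf'']
    rw [abs_mul, abs_mul, abs_of_pos (by positivity : (0 : ℝ) < 1 / v)]
    calc |B'' (x / v)| * (1 / v) * (1 / v) ≤ N₂ * (1 / v) * (1 / v) := by gcongr; exact h2 _
      _ = N₂ / v ^ 2 := by field_simp
  have hmid := abs_sum_sub_integral_le (f := f) (f' := f') (f'' := f'') (D := N₂ / v ^ 2)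
    (a := -(N : ℝ)) (2 * N + 1) (fun x _ ↦ hfd x) (fun x _ ↦ hfd' x) (fun x _ ↦ hD x)
  -- the integral over the cells is the full integral
  have hsupp : Function.support f ⊆ Ioc (-(N : ℝ) - 1 / 2) (-(N : ℝ) - 1 / 2 + ((2 * N + 1 : ℕ) : ℝ)) := by
    intro x hx
    rw [Function.mem_support] at hx
    have habs : |x / v| ≤ 2 := by
      by_contra hcon
      exact hx (hBs _ (not_le.1 hcon))
    rw [abs_div, abs_of_pos hv0, div_le_iff₀ hv0, abs_le] at habs
    constructor
    · linarith [habs.1]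
    · push_cast
      linarith [habs.2]
  have hint : ∫ x in (-(N : ℝ) - 1 / 2)..(-(N : ℝ) - 1 / 2 + ((2 * N + 1 : ℕ) : ℝ)), f x = v * ∫ x, B x := by
    rw [intervalIntegral.integral_eq_integral_of_support_subset hsupp]
    simp only [hf]
    rw [Measure.integral_comp_div B v, abs_of_pos hv0, smul_eq_mul]
  rw [hint] at hmid
  refine hmid.trans ?_
  -- `(2N+1) N₂/(4v²) ≤ 5N₂/(2v)`
  have h1 : ((2 * N + 1 : ℕ) : ℝ) ≤ 4 * v + 3 := by push_cast; linarith
  have h2' : ((2 * N + 1 : ℕ) : ℝ) * (N₂ / v ^ 2 / 4) ≤ (4 * v + 3) * (N₂ / v ^ 2 / 4) :=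
    mul_le_mul_of_nonneg_right h1 (by positivity)
  refine h2'.trans ?_
  rw [show (4 * v + 3) * (N₂ / v ^ 2 / 4) = N₂ * ((4 * v + 3) / (4 * v ^ 2)) by ring,
    show 5 * N₂ / (2 * v) = N₂ * (5 / (2 * v)) by ring]
  refine mul_le_mul_of_nonneg_left ?_ hN₂
  rw [div_le_div_iff₀ (by positivity) (by positivity)]
  nlinarith

/-- **The periodization is continuous on `(0, ∞)`** (locally a finite sum of continuous functions).
[folklore] -/
theorem continuousOn_periodization (hBc : Continuous B) (hBs : ∀ x, 2 < |x| → B x = 0) :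
    ContinuousOn (fun v : ℝ ↦ ∑' m : ℤ, B (m / v)) (Ioi 0) := by
  intro v₀ hv₀
  have hv₀' : (0 : ℝ) < v₀ := hv₀
  set N : ℕ := ⌈4 * v₀⌉₊ with hN
  have hN4 : 4 * v₀ ≤ N := Nat.le_ceil _
  have hcont : ContinuousOn (fun v ↦ ∑ m ∈ Finset.Icc (-(N : ℤ)) N, B (m / v)) (Ioo (v₀ / 2) (2 * v₀)) :=
    continuousOn_finsetSum _ fun m _ ↦ hBc.comp_continuousOn
      (continuousOn_const.div continuousOn_id fun v hv ↦ (by linarith [hv.1] : (0 : ℝ) < v).ne')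
  have heq : EqOn (fun v ↦ ∑' m : ℤ, B (m / v)) (fun v ↦ ∑ m ∈ Finset.Icc (-(N : ℤ)) N, B (m / v))
      (Ioo (v₀ / 2) (2 * v₀)) :=
    fun v hv ↦ periodization_eq_sum hBs (by linarith [hv.1]) (by linarith [hv.2])
  exact ((hcont.congr heq).continuousAt (Ioo_mem_nhds (by linarith) (by linarith))).continuousWithinAt

/-- Pointwise bound for `H(v) = (A(v) - v∫B)/v`: `|H(v)| ≤ (5N₂/2) v⁻²` for `v ≥ 1/2`. [folklore] -/
theorem abs_periodizationH_le {B B' B'' : ℝ → ℝ} {N₂ : ℝ}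
    (hB : ∀ x, HasDerivAt B (B' x) x) (hB' : ∀ x, HasDerivAt B' (B'' x) x)
    (h2 : ∀ x, |B'' x| ≤ N₂) (hBs : ∀ x, 2 < |x| → B x = 0) {v : ℝ} (hv : 1 / 2 ≤ v) :
    |((∑' m : ℤ, B (m / v)) - v * ∫ x, B x) / v| ≤ 5 * N₂ / 2 * v ^ (-2 : ℝ) := by
  have hv0 : 0 < v := by linarith
  rw [abs_div, abs_of_pos hv0, div_le_iff₀ hv0]
  refine (abs_periodization_sub_le hB hB' h2 hBs hv).trans (le_of_eq ?_)
  rw [Real.rpow_neg hv0.le, Real.rpow_two]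
  field_simp

/-- **`H` is integrable on `(a, ∞)` for `a ≥ 1/2`.** [folklore] -/
theorem integrableOn_periodizationH {B B' B'' : ℝ → ℝ} {N₂ : ℝ}
    (hB : ∀ x, HasDerivAt B (B' x) x) (hB' : ∀ x, HasDerivAt B' (B'' x) x)
    (h2 : ∀ x, |B'' x| ≤ N₂) (hBs : ∀ x, 2 < |x| → B x = 0) {a : ℝ} (ha : 1 / 2 ≤ a) :
    IntegrableOn (fun v ↦ ((∑' m : ℤ, B (m / v)) - v * ∫ x, B x) / v) (Ioi a) := by
  have hBc : Continuous B := continuous_iff_continuousAt.2 fun x ↦ (hB x).continuousAt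
  have ha0 : 0 < a := by linarith
  have hmeas : AEStronglyMeasurable (fun v ↦ ((∑' m : ℤ, B (m / v)) - v * ∫ x, B x) / v)
      (volume.restrict (Ioi a)) := by
    refine ContinuousOn.aestronglyMeasurable ?_ measurableSet_Ioi
    refine (((continuousOn_periodization hBc hBs).mono (Ioi_subset_Ioi ha0.le)).sub
      (continuousOn_id.mul continuousOn_const)).div continuousOn_id fun v hv ↦ ?_
    exact (ha0.trans hv).ne'
  refine Integrable.mono' (((integrableOn_Ioi_rpow_of_lt (by norm_num : (-2 : ℝ) < -1) ha0).const_mul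
    (5 * N₂ / 2))) hmeas ?_
  refine (ae_restrict_iff' measurableSet_Ioi).2 (Eventually.of_forall fun v hv ↦ ?_)
  have hv : a < v := hv
  rw [Real.norm_eq_abs]
  exact abs_periodizationH_le hB hB' h2 hBs (by linarith)

/-- **Tail bound**: `|∫_X^∞ H| ≤ 5N₂/(2X)` for `X ≥ 1/2`. [folklore] -/
theorem abs_integral_periodizationH_Ioi_le {B B' B'' : ℝ → ℝ} {N₂ : ℝ}
    (hB : ∀ x, HasDerivAt B (B' x) x) (hB' : ∀ x, HasDerivAt B' (B'' x) x)
    (h2 : ∀ x, |B'' x| ≤ N₂) (hBs : ∀ x, 2 < |x| → B x = 0) {X : ℝ} (hX : 1 / 2 ≤ X) :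
    |∫ v in Ioi X, ((∑' m : ℤ, B (m / v)) - v * ∫ x, B x) / v| ≤ 5 * N₂ / (2 * X) := by
  have hX0 : 0 < X := by linarith
  have hint := integrableOn_periodizationH hB hB' h2 hBs hX
  have hrpow := (integrableOn_Ioi_rpow_of_lt (by norm_num : (-2 : ℝ) < -1) hX0).const_mul (5 * N₂ / 2)
  calc |∫ v in Ioi X, ((∑' m : ℤ, B (m / v)) - v * ∫ x, B x) / v|
      ≤ ∫ v in Ioi X, |((∑' m : ℤ, B (m / v)) - v * ∫ x, B x) / v| := abs_integral_le_integral_abs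
    _ ≤ ∫ v in Ioi X, 5 * N₂ / 2 * v ^ (-2 : ℝ) := by
        refine setIntegral_mono_on hint.abs hrpow measurableSet_Ioi fun v hv ↦ ?_
        exact abs_periodizationH_le hB hB' h2 hBs (le_of_lt (lt_of_le_of_lt hX hv))
    _ = 5 * N₂ / 2 * (-X ^ ((-2 : ℝ) + 1) / ((-2 : ℝ) + 1)) := by
        rw [MeasureTheory.integral_const_mul, integral_Ioi_rpow_of_lt (by norm_num) hX0]
    _ = 5 * N₂ / (2 * X) := by
        rw [show (-2 : ℝ) + 1 = -1 by norm_num, Real.rpow_neg_one]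
        field_simp

/-- **Splitting the `H`-integral**: `∫_{1/2}^∞ H = ∫_{1/2}^X H + ∫_X^∞ H` for `X ≥ 1/2`. [folklore] -/
theorem integral_periodizationH_Ioi_eq_add {B B' B'' : ℝ → ℝ} {N₂ : ℝ}
    (hB : ∀ x, HasDerivAt B (B' x) x) (hB' : ∀ x, HasDerivAt B' (B'' x) x)
    (h2 : ∀ x, |B'' x| ≤ N₂) (hBs : ∀ x, 2 < |x| → B x = 0) {X : ℝ} (hX : 1 / 2 ≤ X) :
    ∫ v in Ioi (1 / 2 : ℝ), ((∑' m : ℤ, B (m / v)) - v * ∫ x, B x) / v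
      = (∫ v in (1 / 2 : ℝ)..X, ((∑' m : ℤ, B (m / v)) - v * ∫ x, B x) / v)
        + ∫ v in Ioi X, ((∑' m : ℤ, B (m / v)) - v * ∫ x, B x) / v := by
  have h1 := integrableOn_periodizationH hB hB' h2 hBs (le_refl (1 / 2 : ℝ))
  have h2' := integrableOn_periodizationH hB hB' h2 hBs hX
  rw [intervalIntegral.integral_of_le hX, ← setIntegral_union Ioc_disjoint_Ioi_same measurableSet_Ioi
    (h1.mono_set Ioc_subset_Ioi_self) h2', Ioc_union_Ioi_eq_Ioi hX]

end Periodization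

end Literature.NumberTheory.LFunctions
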